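import Mathlib
import HarnessLib
import Summits.HubbardSuperconductivity.HubbardSuperconductivity.Theorems.KLProgrammeKLRegimeSoftCovSectorEntrySharp

/-!
# Route `KLProgramme` — ENGINE child gen 8 (stmt-HubbardSuperconductivity-20437 `KLRegimeEngineV17F2`), skeleton v2 class #3 witness input GAP L2-c:
# the Gram HALF-NORMS `‖F_Y‖², ‖G_Y‖²` (BGM (2.80)) of a sectorised normal covariance bounded by the SUM of the symbol over one sector's support,
# the dyadic / annulus-count form for soft-shaped symbols, and replica-Gram-boundedness from half-norm bounds
# (cell gate-hubbard-kl, seat hubbard-kl-k3c2-p2 g9, value/(T) lane; twin of …SectorSubEntrySum / …SoftCovSectorEntrySharp for the κ-data p5 consumes)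

`norm_sq_sectorGramF/G_le` (HubbardSectorPhaseSpaceCount) bound the half-norms by COUNT × SUP; for the soft covariance the sharp law needs the
SUM instead (the symbol is `≍ βL²/ρ` down to the temperature floor), exactly as for the entries.  This file:

* §1 **`norm_sq_sectorGramF_le_of_sum`**, **`norm_sq_sectorGramG_le_of_sum`** — `‖F_ω‖ ≤ 1` ⟹
  `‖F_Y‖² ≤ ‖(βL²)⁻¹‖²·Σ_{k : F_{ω_Y}(k) ≠ 0 ∧ p(k,σ_Y) ≠ 0} ‖p(k, σ_Y)‖` (termwise on `norm_sq_sectorGramF/G`);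
* §2 **`norm_sq_sectorGramF/G_le_of_dyadic`** — soft-shaped symbol `‖p‖ ≤ A/ρ` with `ρmin ≤ ρ ≤ Λ` on the joint support and annulus counts
  `#{k : F_{ω_Y}(k) ≠ 0, r/2 < ρ(k) ≤ r} ≤ C·r²` (`0 < r ≤ Λ`) ⟹ `‖F_Y‖², ‖G_Y‖² ≤ ‖(βL²)⁻¹‖²·(4·A·C·Λ)`, floor-uniform
  (`sum_div_radius_le_of_dyadic_mass'`);
* §3 **`norm_sq_sectorGramF/G_sliceCT_le_of_annulusCount`** — the slice `C^K_{(Λ,Λ′]}` (`0 < Λ ≤ Λ′`, symbol of `hubbardCovSliceCT_zero_seed`):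
  `≤ ‖(βL²)⁻¹‖²·(4·βL²·C·Λ′)` — NO `Λ′/Λ`;
* §4 **`isGramBoundedR_of_halfNorm_le`** — half-norm bounds `‖F_Y‖, ‖G_{Y′}‖ ≤ κ` ⟹ `IsGramBoundedR (S(F)ᵀ·normalCovariance p·S(F)) κ`;
  **`isGramBoundedR_sectorSub_sliceCT_of_annulusCount`** — the slice, from the annulus counts of EVERY sector: `κ = √(‖(βL²)⁻¹‖²·(4βL²CΛ′))`.

Pure bookkeeping over the tree's closed forms; nothing about the model is asserted; nothing asserts superconductivity.
-/

noncomputable section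

namespace Summit.HubbardSuperconductivity.HubbardSuperconductivity.Theorems.TorusFourierL2

set_option linter.dupNamespace false -- summit = problem name (single-conjunct summit), D-0017

open Finset Literature.MathematicalPhysics.QuantumLattice Literature.Probability.LatticeModels
open Summit.HubbardSuperconductivity.HubbardSuperconductivity.Theorems.KLRegimeSplit
open scoped ComplexConjugate InnerProductSpace

variable {L M N : ℕ} [NeZero L]

/-! ## §1 Half-norms by the SUM of the symbol over the joint support -/

/-- The termwise bound behind both half-norms: `Σ_k c²‖F(k)‖²‖p(k,σ)‖ ≤ c²·Σ_{k : F(k) ≠ 0 ∧ p(k,σ) ≠ 0} ‖p(k,σ)‖` for `‖F‖ ≤ 1`. -/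
theorem sum_sq_mul_norm_le_of_norm_le_one (c : ℝ) (f : FreqMomentum L M → ℂ) (hf : ∀ k, ‖f k‖ ≤ 1) (g : FreqMomentum L M → ℂ) :
    ∑ k : FreqMomentum L M, c ^ 2 * ‖f k‖ ^ 2 * ‖g k‖ ≤
      c ^ 2 * ∑ k ∈ (univ : Finset (FreqMomentum L M)).filter (fun k => f k ≠ 0 ∧ g k ≠ 0), ‖g k‖ := by
  classical
  rw [mul_sum]
  have hsplit : ∑ k : FreqMomentum L M, c ^ 2 * ‖f k‖ ^ 2 * ‖g k‖ =
      ∑ k ∈ (univ : Finset (FreqMomentum L M)).filter (fun k => f k ≠ 0 ∧ g k ≠ 0), c ^ 2 * ‖f k‖ ^ 2 * ‖g k‖ := by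
    rw [← sum_subset (subset_univ _) fun k _ hk => ?_]
    have hk' : ¬ (f k ≠ 0 ∧ g k ≠ 0) := fun h => hk (mem_filter.2 ⟨mem_univ _, h⟩)
    by_cases hf0 : f k = 0
    · rw [hf0, norm_zero, zero_pow two_ne_zero, mul_zero, zero_mul]
    · have hg0 : g k = 0 := by by_contra hg; exact hk' ⟨hf0, hg⟩
      rw [hg0, norm_zero, mul_zero]
  rw [hsplit]
  refine sum_le_sum fun k _ => ?_
  have h1 : ‖f k‖ ^ 2 ≤ 1 := by have := hf k; nlinarith [norm_nonneg (f k)]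
  have hc : 0 ≤ c ^ 2 := sq_nonneg c
  calc c ^ 2 * ‖f k‖ ^ 2 * ‖g k‖ ≤ c ^ 2 * 1 * ‖g k‖ := by gcongr
    _ = c ^ 2 * ‖g k‖ := by ring

/-- **Left half-norm by the sum of the symbol**: `‖F_Y‖² ≤ ‖(βL²)⁻¹‖²·Σ_{k : F_{ω_Y}(k) ≠ 0 ∧ p(k,σ_Y) ≠ 0} ‖p(k,σ_Y)‖` for `‖F_ω‖ ≤ 1`.
[cite: BenfattoGiulianiMastropietro2006, §2.8 (2.80)] -/
theorem norm_sq_sectorGramF_le_of_sum (β : ℝ) (F : Fin N → FreqMomentum L M → ℂ) (hF : ∀ ω k, ‖F ω k‖ ≤ 1)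
    (p : FreqMomentum L M × Fin 2 → ℂ) (Y : SpaceTimeIdx L M × SectorLeg N) :
    ‖sectorGramF L M β F p Y‖ ^ 2 ≤ ‖((1 / (β * (L : ℝ) ^ 2) : ℝ) : ℂ)‖ ^ 2 *
      ∑ k ∈ (univ : Finset (FreqMomentum L M)).filter (fun k => F Y.2.1.1 k ≠ 0 ∧ p (k, Y.2.1.2) ≠ 0), ‖p (k, Y.2.1.2)‖ := by
  rw [norm_sq_sectorGramF]
  exact sum_sq_mul_norm_le_of_norm_le_one _ (F Y.2.1.1) (hF Y.2.1.1) (fun k => p (k, Y.2.1.2))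

/-- **Right half-norm by the sum of the symbol.** [cite: BenfattoGiulianiMastropietro2006, §2.8 (2.80)] -/
theorem norm_sq_sectorGramG_le_of_sum (β : ℝ) (F : Fin N → FreqMomentum L M → ℂ) (hF : ∀ ω k, ‖F ω k‖ ≤ 1)
    (p : FreqMomentum L M × Fin 2 → ℂ) (Y' : SpaceTimeIdx L M × SectorLeg N) :
    ‖sectorGramG L M β F p Y'‖ ^ 2 ≤ ‖((1 / (β * (L : ℝ) ^ 2) : ℝ) : ℂ)‖ ^ 2 *
      ∑ k ∈ (univ : Finset (FreqMomentum L M)).filter (fun k => F Y'.2.1.1 k ≠ 0 ∧ p (k, Y'.2.1.2) ≠ 0), ‖p (k, Y'.2.1.2)‖ := by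
  rw [norm_sq_sectorGramG]
  exact sum_sq_mul_norm_le_of_norm_le_one _ (F Y'.2.1.1) (hF Y'.2.1.1) (fun k => p (k, Y'.2.1.2))

/-! ## §2 The dyadic form for soft-shaped symbols -/

/-- The dyadic summation on the joint support: soft shape + radial support + annulus counts of the sector ⟹
`Σ_{k : F(k) ≠ 0 ∧ p(k,σ) ≠ 0} ‖p(k,σ)‖ ≤ 4·A·C·Λ`. -/
theorem sum_norm_symbol_le_of_dyadic (f : FreqMomentum L M → ℂ) (g : FreqMomentum L M → ℂ) (ρ : FreqMomentum L M → ℝ)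
    {Λ ρmin A C : ℝ} (hΛ : 0 < Λ) (hρmin : 0 < ρmin) (hA : 0 ≤ A) (hC : 0 ≤ C)
    (hp : ∀ k, f k ≠ 0 → g k ≠ 0 → ‖g k‖ ≤ A / ρ k)
    (hsupp : ∀ k, f k ≠ 0 → g k ≠ 0 → ρmin ≤ ρ k ∧ ρ k ≤ Λ)
    (hcount : ∀ r : ℝ, 0 < r → r ≤ Λ →
      ((((univ : Finset (FreqMomentum L M)).filter (fun k => f k ≠ 0)).filter fun k => r / 2 < ρ k ∧ ρ k ≤ r).card : ℝ) ≤ C * r ^ 2) :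
    ∑ k ∈ (univ : Finset (FreqMomentum L M)).filter (fun k => f k ≠ 0 ∧ g k ≠ 0), ‖g k‖ ≤ 4 * A * C * Λ := by
  classical
  set T := (univ : Finset (FreqMomentum L M)).filter (fun k => f k ≠ 0 ∧ g k ≠ 0) with hT
  have hmemT : ∀ k, k ∈ T ↔ f k ≠ 0 ∧ g k ≠ 0 := fun k => by rw [hT, mem_filter]; simp
  have h1 : ∑ k ∈ T, ‖g k‖ ≤ ∑ k ∈ T, A / ρ k := sum_le_sum fun k hk => hp k ((hmemT k).1 hk).1 ((hmemT k).1 hk).2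
  refine h1.trans ?_
  have h2 : ∑ k ∈ T, A / ρ k = ∑ k ∈ T, (fun _ => A) k / ρ k := rfl
  rw [h2]
  have h3 := sum_div_radius_le_of_dyadic_mass' (s := T) (f := fun _ => A) (ρ := ρ) (Λ := Λ) (ρmin := ρmin) (C := A * C) hΛ hρmin
    (mul_nonneg hA hC) (fun _ _ => hA) (fun k hk _ => hsupp k ((hmemT k).1 hk).1 ((hmemT k).1 hk).2) ?_
  · calc ∑ k ∈ T, (fun _ => A) k / ρ k ≤ 4 * (A * C) * Λ := h3
      _ = 4 * A * C * Λ := by ring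
  · intro r hr hrΛ
    rw [sum_const, nsmul_eq_mul]
    have hsub : (T.filter fun k => r / 2 < ρ k ∧ ρ k ≤ r) ⊆
        (((univ : Finset (FreqMomentum L M)).filter (fun k => f k ≠ 0)).filter fun k => r / 2 < ρ k ∧ ρ k ≤ r) := by
      intro k hk
      rw [mem_filter] at hk ⊢
      exact ⟨mem_filter.2 ⟨mem_univ _, ((hmemT k).1 hk.1).1⟩, hk.2⟩
    have hle : ((T.filter fun k => r / 2 < ρ k ∧ ρ k ≤ r).card : ℝ) ≤ C * r ^ 2 :=
      le_trans (by exact_mod_cast card_le_card hsub) (hcount r hr hrΛ)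
    calc ((T.filter fun k => r / 2 < ρ k ∧ ρ k ≤ r).card : ℝ) * A ≤ C * r ^ 2 * A := mul_le_mul_of_nonneg_right hle hA
      _ = A * C * r ^ 2 := by ring

/-- **Left half-norm, dyadic form** (floor-uniform): `‖F_Y‖² ≤ ‖(βL²)⁻¹‖²·(4·A·C·Λ)`. [cite: BenfattoGiulianiMastropietro2006, §2.8 (2.80)] -/
theorem norm_sq_sectorGramF_le_of_dyadic (β : ℝ) (F : Fin N → FreqMomentum L M → ℂ) (hF : ∀ ω k, ‖F ω k‖ ≤ 1)
    (p : FreqMomentum L M × Fin 2 → ℂ) (Y : SpaceTimeIdx L M × SectorLeg N) (ρ : FreqMomentum L M → ℝ)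
    {Λ ρmin A C : ℝ} (hΛ : 0 < Λ) (hρmin : 0 < ρmin) (hA : 0 ≤ A) (hC : 0 ≤ C)
    (hp : ∀ k, F Y.2.1.1 k ≠ 0 → p (k, Y.2.1.2) ≠ 0 → ‖p (k, Y.2.1.2)‖ ≤ A / ρ k)
    (hsupp : ∀ k, F Y.2.1.1 k ≠ 0 → p (k, Y.2.1.2) ≠ 0 → ρmin ≤ ρ k ∧ ρ k ≤ Λ)
    (hcount : ∀ r : ℝ, 0 < r → r ≤ Λ →
      ((((univ : Finset (FreqMomentum L M)).filter (fun k => F Y.2.1.1 k ≠ 0)).filter fun k => r / 2 < ρ k ∧ ρ k ≤ r).card : ℝ) ≤ C * r ^ 2) :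
    ‖sectorGramF L M β F p Y‖ ^ 2 ≤ ‖((1 / (β * (L : ℝ) ^ 2) : ℝ) : ℂ)‖ ^ 2 * (4 * A * C * Λ) :=
  (norm_sq_sectorGramF_le_of_sum β F hF p Y).trans (mul_le_mul_of_nonneg_left
    (sum_norm_symbol_le_of_dyadic (F Y.2.1.1) (fun k => p (k, Y.2.1.2)) ρ hΛ hρmin hA hC hp hsupp hcount) (pow_nonneg (norm_nonneg _) 2))

/-- **Right half-norm, dyadic form** (floor-uniform): `‖G_{Y′}‖² ≤ ‖(βL²)⁻¹‖²·(4·A·C·Λ)`. [cite: BenfattoGiulianiMastropietro2006, §2.8 (2.80)] -/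
theorem norm_sq_sectorGramG_le_of_dyadic (β : ℝ) (F : Fin N → FreqMomentum L M → ℂ) (hF : ∀ ω k, ‖F ω k‖ ≤ 1)
    (p : FreqMomentum L M × Fin 2 → ℂ) (Y' : SpaceTimeIdx L M × SectorLeg N) (ρ : FreqMomentum L M → ℝ)
    {Λ ρmin A C : ℝ} (hΛ : 0 < Λ) (hρmin : 0 < ρmin) (hA : 0 ≤ A) (hC : 0 ≤ C)
    (hp : ∀ k, F Y'.2.1.1 k ≠ 0 → p (k, Y'.2.1.2) ≠ 0 → ‖p (k, Y'.2.1.2)‖ ≤ A / ρ k)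
    (hsupp : ∀ k, F Y'.2.1.1 k ≠ 0 → p (k, Y'.2.1.2) ≠ 0 → ρmin ≤ ρ k ∧ ρ k ≤ Λ)
    (hcount : ∀ r : ℝ, 0 < r → r ≤ Λ →
      ((((univ : Finset (FreqMomentum L M)).filter (fun k => F Y'.2.1.1 k ≠ 0)).filter fun k => r / 2 < ρ k ∧ ρ k ≤ r).card : ℝ) ≤ C * r ^ 2) :
    ‖sectorGramG L M β F p Y'‖ ^ 2 ≤ ‖((1 / (β * (L : ℝ) ^ 2) : ℝ) : ℂ)‖ ^ 2 * (4 * A * C * Λ) :=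
  (norm_sq_sectorGramG_le_of_sum β F hF p Y').trans (mul_le_mul_of_nonneg_left
    (sum_norm_symbol_le_of_dyadic (F Y'.2.1.1) (fun k => p (k, Y'.2.1.2)) ρ hΛ hρmin hA hC hp hsupp hcount) (pow_nonneg (norm_nonneg _) 2))

/-! ## §3 The slice `C^K_{(Λ,Λ′]}` -/

/-- **Left half-norm of the sectorised SLICE, β-uniform**: for `‖F_ω‖ ≤ 1`, `0 < Λ ≤ Λ′` and the annulus counts of the sector `ω_Y` for
`0 < r ≤ Λ′`, `‖F_Y‖² ≤ ‖(βL²)⁻¹‖²·(4·βL²·C·Λ′)` (symbol of `hubbardCovSliceCT_zero_seed`). [cite: BenfattoGiulianiMastropietro2006, §2.8 (2.80)] -/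
theorem norm_sq_sectorGramF_sliceCT_le_of_annulusCount [NeZero M] {β : ℝ} (hβ : 0 ≤ β) (μ : ℝ) (K : TrigPolyC4v) {Λ Λ' : ℝ}
    (hΛ : 0 < Λ) (hΛΛ' : Λ ≤ Λ') (F : Fin N → FreqMomentum L M → ℂ) (hF : ∀ ω k, ‖F ω k‖ ≤ 1)
    (Y : SpaceTimeIdx L M × SectorLeg N) {C : ℝ} (hC : 0 ≤ C)
    (hcount : ∀ r : ℝ, 0 < r → r ≤ Λ' →
      ((((univ : Finset (FreqMomentum L M)).filter (fun k => F Y.2.1.1 k ≠ 0)).filter fun k =>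
          r / 2 < Real.sqrt (matsubaraFreq β M k.1 ^ 2 + nambuXiCT L μ K k.2 ^ 2) ∧
            Real.sqrt (matsubaraFreq β M k.1 ^ 2 + nambuXiCT L μ K k.2 ^ 2) ≤ r).card : ℝ) ≤ C * r ^ 2) :
    ‖sectorGramF L M β F
        (fun ks => ((hubbardCutoffWeightCT L M β μ K Λ ks.1 : ℂ) - (hubbardCutoffWeightCT L M β μ K Λ' ks.1 : ℂ)) *
          (((β * (L : ℝ) ^ 2 : ℝ) : ℂ) * ((Complex.I * matsubaraFreq β M ks.1.1 + nambuXiCT L μ K ks.1.2) / nambuDenCT L M β μ 0 K ks.1))) Y‖ ^ 2 ≤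
      ‖((1 / (β * (L : ℝ) ^ 2) : ℝ) : ℂ)‖ ^ 2 * (4 * (β * (L : ℝ) ^ 2) * C * Λ') := by
  refine norm_sq_sectorGramF_le_of_dyadic β F hF _ Y (fun k => Real.sqrt (matsubaraFreq β M k.1 ^ 2 + nambuXiCT L μ K k.2 ^ 2))
    (Λ := Λ') (ρmin := Λ / 2) (A := β * (L : ℝ) ^ 2) (lt_of_lt_of_le hΛ hΛΛ') (by linarith) (by positivity) hC
    (fun k _ _ => norm_sliceSymbolCT_le_div_radius hβ μ K Λ Λ' (k, Y.2.1.2)) (fun k _ hpk => ?_) hcount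
  obtain ⟨hlo, hhi⟩ := sliceSymbolCT_radius_mem (L := L) (M := M) (β := β) μ K hΛ hΛΛ' (ks := (k, Y.2.1.2)) hpk
  exact ⟨hlo.le, hhi.le⟩

/-- **Right half-norm of the sectorised SLICE, β-uniform.** [cite: BenfattoGiulianiMastropietro2006, §2.8 (2.80)] -/
theorem norm_sq_sectorGramG_sliceCT_le_of_annulusCount [NeZero M] {β : ℝ} (hβ : 0 ≤ β) (μ : ℝ) (K : TrigPolyC4v) {Λ Λ' : ℝ}
    (hΛ : 0 < Λ) (hΛΛ' : Λ ≤ Λ') (F : Fin N → FreqMomentum L M → ℂ) (hF : ∀ ω k, ‖F ω k‖ ≤ 1)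
    (Y' : SpaceTimeIdx L M × SectorLeg N) {C : ℝ} (hC : 0 ≤ C)
    (hcount : ∀ r : ℝ, 0 < r → r ≤ Λ' →
      ((((univ : Finset (FreqMomentum L M)).filter (fun k => F Y'.2.1.1 k ≠ 0)).filter fun k =>
          r / 2 < Real.sqrt (matsubaraFreq β M k.1 ^ 2 + nambuXiCT L μ K k.2 ^ 2) ∧
            Real.sqrt (matsubaraFreq β M k.1 ^ 2 + nambuXiCT L μ K k.2 ^ 2) ≤ r).card : ℝ) ≤ C * r ^ 2) :
    ‖sectorGramG L M β F
        (fun ks => ((hubbardCutoffWeightCT L M β μ K Λ ks.1 : ℂ) - (hubbardCutoffWeightCT L M β μ K Λ' ks.1 : ℂ)) *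
          (((β * (L : ℝ) ^ 2 : ℝ) : ℂ) * ((Complex.I * matsubaraFreq β M ks.1.1 + nambuXiCT L μ K ks.1.2) / nambuDenCT L M β μ 0 K ks.1))) Y'‖ ^ 2 ≤
      ‖((1 / (β * (L : ℝ) ^ 2) : ℝ) : ℂ)‖ ^ 2 * (4 * (β * (L : ℝ) ^ 2) * C * Λ') := by
  refine norm_sq_sectorGramG_le_of_dyadic β F hF _ Y' (fun k => Real.sqrt (matsubaraFreq β M k.1 ^ 2 + nambuXiCT L μ K k.2 ^ 2))
    (Λ := Λ') (ρmin := Λ / 2) (A := β * (L : ℝ) ^ 2) (lt_of_lt_of_le hΛ hΛΛ') (by linarith) (by positivity) hC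
    (fun k _ _ => norm_sliceSymbolCT_le_div_radius hβ μ K Λ Λ' (k, Y'.2.1.2)) (fun k _ hpk => ?_) hcount
  obtain ⟨hlo, hhi⟩ := sliceSymbolCT_radius_mem (L := L) (M := M) (β := β) μ K hΛ hΛΛ' (ks := (k, Y'.2.1.2)) hpk
  exact ⟨hlo.le, hhi.le⟩

/-! ## §4 Replica-Gram-boundedness from half-norm bounds -/

/-- Two charges `a, b : Fin 2` with `[a = 0] = [b = 0]` are equal. -/
theorem fin_two_eq_of_decide_eq_zero {a b : Fin 2} (h : decide (a = 0) = decide (b = 0)) : a = b := by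
  fin_cases a <;> fin_cases b <;> simp_all

/-- **Replica-Gram-boundedness from half-norm bounds**: if `‖F_Y‖ ≤ κ` and `‖G_{Y′}‖ ≤ κ` for all labels then
`IsGramBoundedR (S(F)ᵀ·normalCovariance p·S(F)) κ` (charge hypothesis + Gram representation of `HubbardSectorPropagatorGram`).
[cite: BenfattoGiulianiMastropietro2006, §2.8 (2.80)] -/
theorem isGramBoundedR_of_halfNorm_le [NeZero M] (β : ℝ) (F : Fin N → FreqMomentum L M → ℂ) (p : FreqMomentum L M × Fin 2 → ℂ)
    {κ : ℝ} (hκ : 0 ≤ κ) (hFY : ∀ Y : SpaceTimeIdx L M × SectorLeg N, ‖sectorGramF L M β F p Y‖ ≤ κ)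
    (hGY : ∀ Y' : SpaceTimeIdx L M × SectorLeg N, ‖sectorGramG L M β F p Y'‖ ≤ κ) :
    IsGramBoundedR ((sectorSubMatrix L M β F).transpose * normalCovariance L M p * sectorSubMatrix L M β F) κ := by
  classical
  refine isGramBoundedR_of_gram (fun Y : SpaceTimeIdx L M × SectorLeg N => decide (Y.2.2 = 0))
    ((sectorSubMatrix L M β F).transpose * normalCovariance L M p * sectorSubMatrix L M β F)
    (fun Y Y' h => pullback_normalCovariance_apply_of_charge_eq β F p (fin_two_eq_of_decide_eq_zero h))
    (sectorGramF L M β F p) (sectorGramG L M β F p) hκ (fun Y _ => hFY Y) (fun Y' _ => hGY Y') (fun Y Y' hY hY' => ?_)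
  have h0 : Y.2.2 = 0 := of_decide_eq_true hY
  have h1 : Y'.2.2 = 1 := by
    have hne : Y'.2.2 ≠ 0 := fun h => by simp [h] at hY'
    exact Fin.eq_one_of_ne_zero _ hne
  exact contr_pullback_normalCovariance_eq_inner β F p h0 h1

/-- **Replica-Gram constant of the sectorised SLICE from annulus counts of every sector, β-uniform**:
`IsGramBoundedR (S(F)ᵀ·C^K_{(Λ,Λ′]}·S(F)) √(‖(βL²)⁻¹‖²·(4·βL²·C·Λ′))`. [cite: BenfattoGiulianiMastropietro2006, §2.8 (2.80)] -/
theorem isGramBoundedR_sectorSub_sliceCT_of_annulusCount [NeZero M] {β : ℝ} (hβ : 0 ≤ β) (μ : ℝ) (K : TrigPolyC4v) {Λ Λ' : ℝ}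
    (hΛ : 0 < Λ) (hΛΛ' : Λ ≤ Λ') (F : Fin N → FreqMomentum L M → ℂ) (hF : ∀ ω k, ‖F ω k‖ ≤ 1) {C : ℝ} (hC : 0 ≤ C)
    (hcount : ∀ (ω : Fin N) (r : ℝ), 0 < r → r ≤ Λ' →
      ((((univ : Finset (FreqMomentum L M)).filter (fun k => F ω k ≠ 0)).filter fun k =>
          r / 2 < Real.sqrt (matsubaraFreq β M k.1 ^ 2 + nambuXiCT L μ K k.2 ^ 2) ∧
            Real.sqrt (matsubaraFreq β M k.1 ^ 2 + nambuXiCT L μ K k.2 ^ 2) ≤ r).card : ℝ) ≤ C * r ^ 2) :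
    IsGramBoundedR ((sectorSubMatrix L M β F).transpose * hubbardCovSliceCT L M β μ 0 K Λ Λ' * sectorSubMatrix L M β F)
      (Real.sqrt (‖((1 / (β * (L : ℝ) ^ 2) : ℝ) : ℂ)‖ ^ 2 * (4 * (β * (L : ℝ) ^ 2) * C * Λ'))) := by
  rw [hubbardCovSliceCT_zero_seed]
  refine isGramBoundedR_of_halfNorm_le β F _ (Real.sqrt_nonneg _) (fun Y => ?_) (fun Y' => ?_)
  · rw [← Real.sqrt_sq (norm_nonneg (sectorGramF L M β F _ Y))]
    exact Real.sqrt_le_sqrt (norm_sq_sectorGramF_sliceCT_le_of_annulusCount hβ μ K hΛ hΛΛ' F hF Y hC (hcount Y.2.1.1))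
  · rw [← Real.sqrt_sq (norm_nonneg (sectorGramG L M β F _ Y'))]
    exact Real.sqrt_le_sqrt (norm_sq_sectorGramG_sliceCT_le_of_annulusCount hβ μ K hΛ hΛΛ' F hF Y' hC (hcount Y'.2.1.1))

end Summit.HubbardSuperconductivity.HubbardSuperconductivity.Theorems.TorusFourierL2

end
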